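import Mathlib

/-!
# Real-λ blindness of the located permutahedron pencil, part 1 (§1–§2): the conjunction cone `InCone` and the UNIFORM CUBE THEOREM

PORT NOTE (staged by the AUTHOR val-idea-39 g5 for the Negative-lane port pool; critic of record val-idea-crit-9 g3, V#111c booked rev 2 «KERNEL VERIFIED: S2 ANSWERED, no λ_c»): texts VERBATIM BY NAME from the crux workfile `Cruxes/NNDivisionHard/RealLambda39.lean` rev 4 @311ce0a993de (sha16 ce0b080758a4c26c,
farm rc 0 / 0 sorries / 0 warnings), memo `Cruxes/NNDivisionHard/RealLambda39.md` rev 2 @19a32fa804d9.  Deltas vs the workfile: namespace `…Theorems.NNDivisionHardNegative.RealLambda` (sibling of `…WeakReliefBlind`), split into three parts (§1–§2 / §3+§5 / §4), this header.  CENSUS / CALIBRATION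
theorems about ONE certificate family (conjunctions of boundedly many literals on a size class); no item closes; VP ≠ VNP is NOT proved; the crux
`NNDivisionHard` (stmt-ValiantsHypothesis-21181) stays OPEN; nothing here bears on its status.

§1 `InCone D f`: the cone of nonnegative real combinations of conjunctions `[S ⊆ a]·[T ∩ a = ∅]` of `|S|+|T| ≤ D` literals, as an inductive predicate on row
functions `Finset (Fin n) → ℝ`; closure under sums, nonnegative scaling, multiplication by a literal (`D ↦ D+1`), CONDITIONING (`InCone.cond`:
`f = X_v·f(insert v ·) + (1−X_v)·f(erase · v)`), and coefficient extraction `InCone.coeffs`.  §2 the cube polynomials `cubeF` (`e = 0`) / `cubeT` (`e = 1`)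
of a column `V` with per-element reliefs `c` and polarities `P` (insiders relieved when absent, outsiders when present), Fact 1 (`cubeT_inCone`), the two
conditioning identities, the FAR BASE `cubeF_far` (symmetric relief identity `t(1−s−u)² = −(t−2)(t−s) + (t−1)(s²−s) + (t−s)(t−s−1) + t(u²−2u+2su)`),
and the UNIFORM CUBE THEOREM `cubeF_inCone : N ⊆ V → 0 ≤ κ → (c ≥ 0 on V) → (c ≥ 1 on V ∖ N) → InCone (|N|+2) (cubeF P c V κ)` — condition on the near
elements, far ones are paid by their reliefs.  This is where a REAL dilation `λ > 0` enters (part 2 takes `c = (λ/2)·dist`).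
-/

-- the mandated summit-side namespace repeats a component by design (single-problem summit)
set_option linter.dupNamespace false

namespace Summit.ValiantsHypothesis.Theorems.NNDivisionHardNegative.RealLambda

open Finset

noncomputable section

variable {n : ℕ}

/-! ## §1 The conjunction cone -/

/-- real `0/1` indicator `X_e(a) = [e ∈ a]` -/
def X (a : Finset (Fin n)) (e : Fin n) : ℝ := if e ∈ a then 1 else 0

/-- the conjunction slot `[S ⊆ a]·[T ∩ a = ∅]` -/
def cj (S T : Finset (Fin n)) (a : Finset (Fin n)) : ℝ := if S ⊆ a ∧ Disjoint T a then 1 else 0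

/-- Port helper `X_nonneg` (statement and proof verbatim from the crux workfile; see the file header). -/
theorem X_nonneg (a : Finset (Fin n)) (e : Fin n) : 0 ≤ X a e := by
  unfold X; split_ifs <;> norm_num

/-- Port helper `X_le_one` (statement and proof verbatim from the crux workfile; see the file header). -/
theorem X_le_one (a : Finset (Fin n)) (e : Fin n) : X a e ≤ 1 := by
  unfold X; split_ifs <;> norm_num

/-- Port helper `X_mul_self` (statement and proof verbatim from the crux workfile; see the file header). -/
theorem X_mul_self (a : Finset (Fin n)) (e : Fin n) : X a e * X a e = X a e := by
  unfold X; split_ifs <;> norm_num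

/-- Port helper `cj_nonneg` (statement and proof verbatim from the crux workfile; see the file header). -/
theorem cj_nonneg (S T a : Finset (Fin n)) : 0 ≤ cj S T a := by
  unfold cj; split_ifs <;> norm_num

/-- `Σ_{e ∈ b} X_e(a) = |a ∩ b|` -/
theorem sum_X (a b : Finset (Fin n)) : ∑ e ∈ b, X a e = ((a ∩ b).card : ℝ) := by
  classical
  unfold X
  rw [Finset.sum_boole]
  congr 2
  ext e; simp [Finset.mem_inter, and_comm]

/-- the cone of conjunctions of at most `D` literals: nonnegative real combinations, as an inductive predicate -/
inductive InCone : ℕ → (Finset (Fin n) → ℝ) → Prop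
  | atom {D : ℕ} {w : ℝ} {S T : Finset (Fin n)} (hw : 0 ≤ w) (hST : S.card + T.card ≤ D) :
      InCone D (fun a => w * cj S T a)
  | add {D : ℕ} {f g : Finset (Fin n) → ℝ} : InCone D f → InCone D g → InCone D (fun a => f a + g a)

namespace InCone

/-- Port helper `congr` (statement and proof verbatim from the crux workfile; see the file header). -/
theorem congr {D : ℕ} {f g : Finset (Fin n) → ℝ} (hf : InCone D f) (h : ∀ a, f a = g a) : InCone D g := by
  have hfg : f = g := funext h
  exact hfg ▸ hf

/-- Port helper `mono` (statement and proof verbatim from the crux workfile; see the file header). -/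
theorem mono {D D' : ℕ} {f : Finset (Fin n) → ℝ} (hf : InCone D f) (hD : D ≤ D') : InCone D' f := by
  induction hf with
  | atom hw hST => exact InCone.atom hw (hST.trans hD)
  | add _ _ ihf ihg => exact InCone.add ihf ihg

/-- Port helper `const` (statement and proof verbatim from the crux workfile; see the file header). -/
theorem const (D : ℕ) {w : ℝ} (hw : 0 ≤ w) : InCone D (fun _ : Finset (Fin n) => w) := by
  have h := InCone.atom (n := n) (D := D) (S := ∅) (T := ∅) hw (by simp)
  exact h.congr (fun a => by simp [cj])

/-- Port helper `smul` (statement and proof verbatim from the crux workfile; see the file header). -/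
theorem smul {D : ℕ} {f : Finset (Fin n) → ℝ} {w : ℝ} (hw : 0 ≤ w) (hf : InCone D f) :
    InCone D (fun a => w * f a) := by
  induction hf with
  | atom hw' hST => exact (InCone.atom (mul_nonneg hw hw') hST).congr (fun a => by ring)
  | add _ _ ihf ihg => exact (InCone.add ihf ihg).congr (fun a => by ring)

/-- Port helper `sum` (statement and proof verbatim from the crux workfile; see the file header). -/
theorem sum {D : ℕ} {ι : Type*} (s : Finset ι) (f : ι → Finset (Fin n) → ℝ) (h : ∀ i ∈ s, InCone D (f i)) :
    InCone D (fun a => ∑ i ∈ s, f i a) := by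
  classical
  induction s using Finset.induction_on with
  | empty => exact (const D le_rfl).congr (fun a => by simp)
  | @insert i s hi ih =>
      have h1 : InCone D (f i) := h i (Finset.mem_insert_self i s)
      have h2 : InCone D (fun a => ∑ j ∈ s, f j a) := ih (fun j hj => h j (Finset.mem_insert_of_mem hj))
      exact (InCone.add h1 h2).congr (fun a => by rw [Finset.sum_insert hi])

/-- multiplication by a positive literal `X_e` raises the degree by one -/
theorem mulX {D : ℕ} {f : Finset (Fin n) → ℝ} (e : Fin n) (hf : InCone D f) :
    InCone (D + 1) (fun a => X a e * f a) := by
  classical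
  induction hf with
  | @atom w S T hw hST =>
      refine (InCone.atom (S := insert e S) (T := T) hw ?_).congr (fun a => ?_)
      · have := Finset.card_insert_le e S
        omega
      · unfold cj X
        by_cases he : e ∈ a
        · simp [he, Finset.insert_subset_iff]
        · simp [he, Finset.insert_subset_iff]
  | add _ _ ihf ihg => exact (InCone.add ihf ihg).congr (fun a => by ring)

/-- multiplication by a negative literal `1 − X_e` raises the degree by one -/
theorem mulNX {D : ℕ} {f : Finset (Fin n) → ℝ} (e : Fin n) (hf : InCone D f) :
    InCone (D + 1) (fun a => (1 - X a e) * f a) := by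
  classical
  induction hf with
  | @atom w S T hw hST =>
      refine (InCone.atom (S := S) (T := insert e T) hw ?_).congr (fun a => ?_)
      · have := Finset.card_insert_le e T
        omega
      · unfold cj X
        by_cases he : e ∈ a
        · simp [he, Finset.disjoint_insert_left]
        · simp [he, Finset.disjoint_insert_left]
  | add _ _ ihf ihg => exact (InCone.add ihf ihg).congr (fun a => by ring)

/-- CONDITIONING on the coordinate `e`: `f = X_e·f(insert e ·) + (1−X_e)·f(erase · e)`. -/
theorem cond {D : ℕ} {f : Finset (Fin n) → ℝ} (e : Fin n)
    (h1 : InCone D (fun a => f (insert e a))) (h0 : InCone D (fun a => f (a.erase e))) : InCone (D + 1) f := by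
  classical
  refine (InCone.add (mulX e h1) (mulNX e h0)).congr (fun a => ?_)
  unfold X
  by_cases he : e ∈ a
  · simp [he, Finset.insert_eq_of_mem he]
  · simp [he]

/-- the positive literal, the negative literal and products of two literals are in the cone -/
theorem litX (e : Fin n) : InCone 1 (fun a : Finset (Fin n) => X a e) :=
  (mulX e (const 0 zero_le_one)).congr (fun a => by ring)

/-- Port helper `litNX` (statement and proof verbatim from the crux workfile; see the file header). -/
theorem litNX (e : Fin n) : InCone 1 (fun a : Finset (Fin n) => 1 - X a e) :=
  (mulNX e (const 0 zero_le_one)).congr (fun a => by ring)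

/-- Port helper `XX` (statement and proof verbatim from the crux workfile; see the file header). -/
theorem XX (e e' : Fin n) : InCone 2 (fun a : Finset (Fin n) => X a e * X a e') := mulX e (litX e')

/-- Port helper `NXNX` (statement and proof verbatim from the crux workfile; see the file header). -/
theorem NXNX (e e' : Fin n) : InCone 2 (fun a : Finset (Fin n) => (1 - X a e) * (1 - X a e')) := mulNX e (litNX e')

/-- coefficient extraction: an `InCone D` function is an explicit nonnegative combination of slots of degree `≤ D`. -/
theorem coeffs {D : ℕ} {f : Finset (Fin n) → ℝ} (hf : InCone D f) :
    ∃ c : Finset (Fin n) × Finset (Fin n) → ℝ, (∀ p, 0 ≤ c p) ∧ (∀ p, D < p.1.card + p.2.card → c p = 0) ∧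
      ∀ a, f a = ∑ p, c p * cj p.1 p.2 a := by
  classical
  induction hf with
  | @atom w S T hw hST =>
      refine ⟨fun p => if p = (S, T) then w else 0, fun p => ?_, fun p hp => ?_, fun a => ?_⟩
      · dsimp only; split_ifs <;> linarith
      · dsimp only; split_ifs with h
        · subst h; dsimp only at hp; omega
        · rfl
      · simp only [ite_mul, zero_mul, Finset.sum_ite_eq', Finset.mem_univ, if_true]
  | add hf hg ihf ihg =>
      obtain ⟨c₁, h₁, d₁, e₁⟩ := ihf
      obtain ⟨c₂, h₂, d₂, e₂⟩ := ihg
      refine ⟨fun p => c₁ p + c₂ p, fun p => add_nonneg (h₁ p) (h₂ p), fun p hp => by simp [d₁ p hp, d₂ p hp], fun a => ?_⟩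
      dsimp only
      rw [e₁ a, e₂ a, ← Finset.sum_add_distrib]
      exact Finset.sum_congr rfl fun p _ => by ring

end InCone

/-! ## §2 The cube polynomials and the uniform cube theorem -/

/-- relief literal: insiders (`u ∈ P`) are relieved when ABSENT, outsiders when PRESENT -/
def lit (P : Finset (Fin n)) (u : Fin n) (a : Finset (Fin n)) : ℝ := if u ∈ P then 1 - X a u else X a u

/-- Port helper `lit_inCone` (statement and proof verbatim from the crux workfile; see the file header). -/
theorem lit_inCone (P : Finset (Fin n)) (u : Fin n) : InCone 1 (lit P u) := by
  by_cases hu : u ∈ P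
  · exact (InCone.litNX u).congr (fun a => by simp [lit, hu])
  · exact (InCone.litX u).congr (fun a => by simp [lit, hu])

/-- cube polynomial with NO conditioned element present (`e = 0`): `κ + (1 − Σ_V X)² + Σ_V c_u ℓ_u` -/
def cubeF (P : Finset (Fin n)) (c : Fin n → ℝ) (V : Finset (Fin n)) (κ : ℝ) (a : Finset (Fin n)) : ℝ :=
  κ + (1 - ∑ u ∈ V, X a u) ^ 2 + ∑ u ∈ V, c u * lit P u a

/-- cube polynomial AFTER a present conditioned element (`e = 1`): `κ + (Σ_V X)² + Σ_V c_u ℓ_u` -/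
def cubeT (P : Finset (Fin n)) (c : Fin n → ℝ) (V : Finset (Fin n)) (κ : ℝ) (a : Finset (Fin n)) : ℝ :=
  κ + (∑ u ∈ V, X a u) ^ 2 + ∑ u ∈ V, c u * lit P u a

section Cube
variable (P : Finset (Fin n)) (c : Fin n → ℝ)

/-- FACT 1: once a conditioned element is present, the polynomial is in the degree-2 cone outright. -/
theorem cubeT_inCone {V : Finset (Fin n)} {κ : ℝ} (hκ : 0 ≤ κ) (hc : ∀ u ∈ V, 0 ≤ c u) :
    InCone 2 (cubeT P c V κ) := by
  have h1 : InCone 2 (fun a : Finset (Fin n) => ∑ u ∈ V, ∑ u' ∈ V, X a u * X a u') :=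
    InCone.sum V _ fun u _ => InCone.sum V _ fun u' _ => InCone.XX u u'
  have h2 : InCone 2 (fun a : Finset (Fin n) => ∑ u ∈ V, c u * lit P u a) :=
    InCone.sum V _ fun u hu => (InCone.smul (hc u hu) (lit_inCone P u)).mono (by norm_num)
  refine (InCone.add (InCone.add (InCone.const 2 hκ) h1) h2).congr (fun a => ?_)
  unfold cubeT
  rw [sq, Finset.sum_mul_sum]

variable {P c}

/-- Port helper `X_insert_self` (statement and proof verbatim from the crux workfile; see the file header). -/
theorem X_insert_self (a : Finset (Fin n)) (v : Fin n) : X (insert v a) v = 1 := by simp [X]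
/-- Port helper `X_erase_self` (statement and proof verbatim from the crux workfile; see the file header). -/
theorem X_erase_self (a : Finset (Fin n)) (v : Fin n) : X (a.erase v) v = 0 := by simp [X]
/-- Port helper `X_insert_ne` (statement and proof verbatim from the crux workfile; see the file header). -/
theorem X_insert_ne (a : Finset (Fin n)) {u v : Fin n} (h : u ≠ v) : X (insert v a) u = X a u := by simp [X, h]
/-- Port helper `X_erase_ne` (statement and proof verbatim from the crux workfile; see the file header). -/
theorem X_erase_ne (a : Finset (Fin n)) {u v : Fin n} (h : u ≠ v) : X (a.erase v) u = X a u := by simp [X, h]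
/-- Port helper `lit_insert_ne` (statement and proof verbatim from the crux workfile; see the file header). -/
theorem lit_insert_ne (a : Finset (Fin n)) {u v : Fin n} (h : u ≠ v) : lit P u (insert v a) = lit P u a := by
  simp [lit, X_insert_ne a h]
/-- Port helper `lit_erase_ne` (statement and proof verbatim from the crux workfile; see the file header). -/
theorem lit_erase_ne (a : Finset (Fin n)) {u v : Fin n} (h : u ≠ v) : lit P u (a.erase v) = lit P u a := by
  simp [lit, X_erase_ne a h]
/-- Port helper `lit_insert_self` (statement and proof verbatim from the crux workfile; see the file header). -/
theorem lit_insert_self (a : Finset (Fin n)) (v : Fin n) : lit P v (insert v a) = if v ∈ P then 0 else 1 := by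
  by_cases hv : v ∈ P <;> simp [lit, hv, X_insert_self]
/-- Port helper `lit_erase_self` (statement and proof verbatim from the crux workfile; see the file header). -/
theorem lit_erase_self (a : Finset (Fin n)) (v : Fin n) : lit P v (a.erase v) = if v ∈ P then 1 else 0 := by
  by_cases hv : v ∈ P <;> simp [lit, hv, X_erase_self]

/-- conditioning identity, PRESENT branch -/
theorem cubeF_insert {V : Finset (Fin n)} {v : Fin n} (hv : v ∈ V) (κ : ℝ) (a : Finset (Fin n)) :
    cubeF P c V κ (insert v a) = cubeT P c (V.erase v) (κ + if v ∈ P then 0 else c v) a := by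
  unfold cubeF cubeT
  rw [← Finset.add_sum_erase V _ hv, ← Finset.add_sum_erase V (fun u => c u * lit P u (insert v a)) hv]
  rw [X_insert_self, lit_insert_self]
  have e1 : ∑ u ∈ V.erase v, X (insert v a) u = ∑ u ∈ V.erase v, X a u :=
    Finset.sum_congr rfl fun u hu => X_insert_ne a (Finset.ne_of_mem_erase hu)
  have e2 : ∑ u ∈ V.erase v, c u * lit P u (insert v a) = ∑ u ∈ V.erase v, c u * lit P u a :=
    Finset.sum_congr rfl fun u hu => by rw [lit_insert_ne a (Finset.ne_of_mem_erase hu)]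
  rw [e1, e2]
  split_ifs <;> ring

/-- conditioning identity, ABSENT branch -/
theorem cubeF_erase {V : Finset (Fin n)} {v : Fin n} (hv : v ∈ V) (κ : ℝ) (a : Finset (Fin n)) :
    cubeF P c V κ (a.erase v) = cubeF P c (V.erase v) (κ + if v ∈ P then c v else 0) a := by
  unfold cubeF
  rw [← Finset.add_sum_erase V _ hv, ← Finset.add_sum_erase V (fun u => c u * lit P u (a.erase v)) hv]
  rw [X_erase_self, lit_erase_self]
  have e1 : ∑ u ∈ V.erase v, X (a.erase v) u = ∑ u ∈ V.erase v, X a u :=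
    Finset.sum_congr rfl fun u hu => X_erase_ne a (Finset.ne_of_mem_erase hu)
  have e2 : ∑ u ∈ V.erase v, c u * lit P u (a.erase v) = ∑ u ∈ V.erase v, c u * lit P u a :=
    Finset.sum_congr rfl fun u hu => by rw [lit_erase_ne a (Finset.ne_of_mem_erase hu)]
  rw [e1, e2]
  split_ifs <;> ring

/-- pair sums: `Σ_{i} Σ_{i′ ≠ i} f_i f_{i′} = (Σ f)² − Σ f²` -/
theorem sum_sum_erase (I : Finset (Fin n)) (f : Fin n → ℝ) :
    ∑ i ∈ I, ∑ i' ∈ I.erase i, f i * f i' = (∑ i ∈ I, f i) ^ 2 - ∑ i ∈ I, f i * f i := by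
  have h : ∀ i ∈ I, ∑ i' ∈ I.erase i, f i * f i' = f i * (∑ i' ∈ I, f i') - f i * f i := by
    intro i hi
    rw [← Finset.mul_sum, Finset.sum_erase_eq_sub hi, mul_sub]
  rw [Finset.sum_congr rfl h, Finset.sum_sub_distrib, ← Finset.sum_mul, sq]

/-- THE FAR BASE: if every relief in `V` is `≥ 1`, the unconditioned cube polynomial is in the degree-2 cone for every `κ ≥ 0`
(symmetric relief identity; `t = |V ∩ P|`, `s = |a ∩ V ∩ P|`, `u = |a ∩ V ∖ P|`:
`t(1−s−u)² = −(t−2)(t−s) + (t−1)(s²−s) + (t−s)(t−s−1) + t(u² − 2u + 2su)`). -/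
theorem cubeF_far {V : Finset (Fin n)} {κ : ℝ} (hκ : 0 ≤ κ) (hc : ∀ u ∈ V, 1 ≤ c u) :
    InCone 2 (cubeF P c V κ) := by
  classical
  set I := V.filter (fun u => u ∈ P) with hI
  set O := V.filter (fun u => u ∉ P) with hO
  have hIP : ∀ i ∈ I, i ∈ P := fun i hi => (Finset.mem_filter.mp hi).2
  have hOP : ∀ j ∈ O, j ∉ P := fun j hj => (Finset.mem_filter.mp hj).2
  have hIV : ∀ i ∈ I, i ∈ V := fun i hi => (Finset.mem_filter.mp hi).1
  have hOV : ∀ j ∈ O, j ∈ V := fun j hj => (Finset.mem_filter.mp hj).1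
  -- the common outsider part: Σ_O (c_j − 1) X_j + 2 Σ_{I×O} X_i X_j + Σ_{j ≠ j′ ∈ O} X_j X_{j′}
  have hOut : InCone 2 (fun a : Finset (Fin n) => ∑ j ∈ O, (c j - 1) * X a j +
      2 * ∑ i ∈ I, ∑ j ∈ O, X a i * X a j + ∑ j ∈ O, ∑ j' ∈ O.erase j, X a j * X a j') := by
    refine InCone.add (InCone.add ?_ ?_) ?_
    · exact InCone.sum O _ fun j hj => (InCone.smul (by linarith [hc j (hOV j hj)]) (InCone.litX j)).mono (by norm_num)
    · exact InCone.smul (by norm_num) (InCone.sum I _ fun i _ => InCone.sum O _ fun j _ => InCone.XX i j)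
    · exact InCone.sum O _ fun j _ => InCone.sum (O.erase j) _ fun j' _ => InCone.XX j j'
  -- splitting the sums over V
  have splitX : ∀ a : Finset (Fin n), ∑ u ∈ V, X a u = ∑ i ∈ I, X a i + ∑ j ∈ O, X a j := fun a =>
    (Finset.sum_filter_add_sum_filter_not V (fun u => u ∈ P) _).symm
  have splitR : ∀ a : Finset (Fin n), ∑ u ∈ V, c u * lit P u a =
      ∑ i ∈ I, c i * (1 - X a i) + ∑ j ∈ O, c j * X a j := by
    intro a
    rw [← Finset.sum_filter_add_sum_filter_not V (fun u => u ∈ P)]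
    congr 1
    · exact Finset.sum_congr rfl fun i hi => by rw [show lit P i a = 1 - X a i by simp [lit, hIP i hi]]
    · exact Finset.sum_congr rfl fun j hj => by rw [show lit P j a = X a j by simp [lit, hOP j hj]]
  -- pair-sum evaluations
  have pairX : ∀ (A : Finset (Fin n)) (a : Finset (Fin n)),
      ∑ i ∈ A, ∑ i' ∈ A.erase i, X a i * X a i' = (∑ i ∈ A, X a i) ^ 2 - ∑ i ∈ A, X a i := by
    intro A a
    rw [sum_sum_erase]
    congr 1
    exact Finset.sum_congr rfl fun i _ => X_mul_self a i
  have pairNX : ∀ (A : Finset (Fin n)) (a : Finset (Fin n)),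
      ∑ i ∈ A, ∑ i' ∈ A.erase i, (1 - X a i) * (1 - X a i') = (∑ i ∈ A, (1 - X a i)) ^ 2 - ∑ i ∈ A, (1 - X a i) := by
    intro A a
    rw [sum_sum_erase A (fun i => 1 - X a i)]
    congr 1
    refine Finset.sum_congr rfl fun i _ => ?_
    have := X_mul_self a i
    ring_nf; nlinarith [this]
  have sumNX : ∀ (A : Finset (Fin n)) (a : Finset (Fin n)), ∑ i ∈ A, (1 - X a i) = (A.card : ℝ) - ∑ i ∈ A, X a i := by
    intro A a
    rw [Finset.sum_sub_distrib, Finset.sum_const, nsmul_eq_mul, mul_one]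
  rcases Nat.eq_zero_or_pos I.card with ht | ht
  · -- no insiders: `κ + 1 + outsider part`
    have hIe : I = ∅ := Finset.card_eq_zero.mp ht
    refine (InCone.add (InCone.const 2 (show (0:ℝ) ≤ κ + 1 by linarith)) hOut).congr (fun a => ?_)
    unfold cubeF
    rw [splitX a, splitR a, hIe]
    simp only [Finset.sum_empty, zero_add]
    have p2 := pairX O a
    set u := ∑ j ∈ O, X a j with hu
    have eO : ∑ j ∈ O, (c j - 1) * X a j = ∑ j ∈ O, c j * X a j - u := by
      rw [hu, ← Finset.sum_sub_distrib]; exact Finset.sum_congr rfl fun j _ => by ring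
    rw [p2, eO]
    ring
  · -- `t ≥ 1` insiders: symmetric relief identity
    have htR : (0:ℝ) < (I.card : ℝ) := by exact_mod_cast ht
    set t : ℝ := (I.card : ℝ) with htdef
    have hIn : InCone 2 (fun a : Finset (Fin n) => ∑ i ∈ I, (c i - (t - 2) / t) * (1 - X a i) +
        ((t - 1) / t) * ∑ i ∈ I, ∑ i' ∈ I.erase i, X a i * X a i' +
        (1 / t) * ∑ i ∈ I, ∑ i' ∈ I.erase i, (1 - X a i) * (1 - X a i')) := by
      refine InCone.add (InCone.add ?_ ?_) ?_
      · refine InCone.sum I _ fun i hi => (InCone.smul ?_ (InCone.litNX i)).mono (by norm_num)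
        have h1 := hc i (hIV i hi)
        have : (t - 2) / t ≤ 1 := by rw [div_le_one htR]; linarith
        linarith
      · refine InCone.smul ?_ (InCone.sum I _ fun i _ => InCone.sum (I.erase i) _ fun i' _ => InCone.XX i i')
        have : (1:ℝ) ≤ t := by rw [htdef]; exact_mod_cast (ht : 1 ≤ I.card)
        exact div_nonneg (by linarith) htR.le
      · exact InCone.smul (by positivity) (InCone.sum I _ fun i _ => InCone.sum (I.erase i) _ fun i' _ => InCone.NXNX i i')
    refine (InCone.add (InCone.add (InCone.const 2 hκ) hIn) hOut).congr (fun a => ?_)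
    unfold cubeF
    rw [splitX a, splitR a, pairX I a, pairNX I a, pairX O a, sumNX I a, ← Finset.sum_mul_sum]
    set s := ∑ i ∈ I, X a i with hs
    set u := ∑ j ∈ O, X a j with hu
    have eI : ∑ i ∈ I, (c i - (t - 2) / t) * (1 - X a i) = ∑ i ∈ I, c i * (1 - X a i) - ((t - 2) / t) * (t - s) := by
      rw [← sumNX I a, Finset.mul_sum, ← Finset.sum_sub_distrib]
      exact Finset.sum_congr rfl fun i _ => by ring
    have eO : ∑ j ∈ O, (c j - 1) * X a j = ∑ j ∈ O, c j * X a j - u := by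
      rw [hu, ← Finset.sum_sub_distrib]; exact Finset.sum_congr rfl fun j _ => by ring
    rw [eI, eO]
    have hst : t ≠ 0 := htR.ne'
    rw [show ((I.card : ℕ) : ℝ) = t from rfl]
    field_simp
    ring

/-- ★ THE UNIFORM CUBE THEOREM: if the reliefs are nonnegative on `V` and `≥ 1` off a set `N ⊆ V` of "near" elements, then the
unconditioned cube polynomial lies in the cone of conjunctions of at most `|N| + 2` literals (condition on the elements of `N` one at a
time: a PRESENT branch is a Fact-1 leaf, the all-absent leaf is the far base). -/
theorem cubeF_inCone (N : Finset (Fin n)) :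
    ∀ (V : Finset (Fin n)) (κ : ℝ), N ⊆ V → 0 ≤ κ → (∀ u ∈ V, 0 ≤ c u) → (∀ u ∈ V, u ∉ N → 1 ≤ c u) →
      InCone (N.card + 2) (cubeF P c V κ) := by
  classical
  induction N using Finset.induction_on with
  | empty =>
      intro V κ _ hκ _ hc1
      simpa using cubeF_far (P := P) (c := c) hκ (fun u hu => hc1 u hu (Finset.notMem_empty u))
  | @insert v N hvN ih =>
      intro V κ hNV hκ hc0 hc1
      have hv : v ∈ V := hNV (Finset.mem_insert_self v N)
      have hcv : 0 ≤ c v := hc0 v hv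
      have h1 : InCone (N.card + 2) (fun a => cubeF P c V κ (insert v a)) := by
        have := cubeT_inCone P c (V := V.erase v) (κ := κ + if v ∈ P then 0 else c v)
          (by split_ifs <;> linarith) (fun u hu => hc0 u (Finset.mem_of_mem_erase hu))
        exact (this.mono (by omega)).congr (fun a => (cubeF_insert hv κ a).symm)
      have h0 : InCone (N.card + 2) (fun a => cubeF P c V κ (a.erase v)) := by
        have := ih (V.erase v) (κ + if v ∈ P then c v else 0)
          (fun u hu => Finset.mem_erase.mpr ⟨fun h => hvN (h ▸ hu), hNV (Finset.mem_insert_of_mem hu)⟩)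
          (by split_ifs <;> linarith) (fun u hu => hc0 u (Finset.mem_of_mem_erase hu))
          (fun u hu huN => hc1 u (Finset.mem_of_mem_erase hu)
            (by rw [Finset.mem_insert]; exact not_or.mpr ⟨Finset.ne_of_mem_erase hu, huN⟩))
        exact this.congr (fun a => (cubeF_erase hv _ a).symm)
      have h := InCone.cond v h1 h0
      have hcard : (insert v N).card + 2 = N.card + 2 + 1 := by
        rw [Finset.card_insert_of_notMem hvN]
      rw [hcard]
      exact h

end Cube

end

end Summit.ValiantsHypothesis.Theorems.NNDivisionHardNegative.RealLambda
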